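import Literature.AlgebraicGeometry.ShimuraVarieties.UnitaryAuxiliarySymplecticLevel
import HarnessLib

/-!
# The diagonal blocks of the frame-free carrier: `W₀`-corner `t ↦ res(t′)` and `V`-corner `(k, t) ↦ res(t′·X′)`

Deligne's auxiliary construction [cite: Deligne1979ShimuraVarieties, Prop. 2.3.10 (PDF p. 32)] reads the
group `U(H)(𝔸_f) × T₀(M)(𝔸_f)` inside `GL(W₀ ⊕ V_M)(𝔸_{ℚ,f})` through the block embedding
`(k, t) ↦ diag(t′, t′·X′)` (★ `blockGL`) followed by restriction of scalars along the `𝔸_{ℚ,f}`-basis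
`eᵢ ⊗ (1 ⊗ b_k)` (★ `resGL`, ★ `auxResFin`).  The carrier is BLOCK DIAGONAL for the decomposition
`W₀ ⊕ V_M`; this file isolates its two diagonal blocks as homomorphisms in their own right —

* `auxResW₀ M : T₀(M)(𝔸_f) →* GL_{1 × [M:ℚ]}(𝔸_{ℚ,f})`, `t ↦ res(t′ • 1)` (the scalar action of the torus on `W₀ = M`);
* `auxResV M j H : U(H)(𝔸_f) × T₀(M)(𝔸_f) →* GL_{3 × [M:ℚ]}(𝔸_{ℚ,f})`, `(k, t) ↦ res(t′ • X′)`
  (the action on `V_M = V ⊗_L M`);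

proves the block identity `reindex (auxResFin p) = fromBlocks (auxResW₀ p.2) 0 0 (auxResV p)` along
`(Fin 1 ⊕ Fin 3) × Fin d ≃ (Fin 1 × Fin d) ⊕ (Fin 3 × Fin d)`, and their continuity (read off ★
`continuous_coe_auxResFin`).  These are the inputs of the SPLIT-LATTICE step of the level analysis of
[cite: Deligne1971TravauxShimura, Prop. 1.15 p. 132]: a compact `K × L₀` stabilises a lattice in `W₀` and a
lattice in `V_M` separately (★ `Adeles.exists_rat_conj_entries_mem_integralFiniteAdeles` applied to each corner).

Topic `AlgebraicGeometry/ShimuraVarieties`; namespace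
`Literature.AlgebraicGeometry.ShimuraVarieties.UnitaryCanonicalModel.Aux`.  Definitions with bodies and
theorems; no named fact, no instance, nothing asserted.
-/

set_option autoImplicit false

noncomputable section

open Matrix NumberField IsDedekindDomain
open _root_.Topology
open scoped TensorProduct NumberField.AdeleRing

namespace Literature.AlgebraicGeometry.ShimuraVarieties.UnitaryCanonicalModel.Aux

open Literature.AlgebraicGeometry.ModuliOfAbelianVarieties
open Literature.NumberTheory.ComplexMultiplication (ratFiniteAdeleTensorEquiv ratFiniteAdeleTensorEquiv_symm_algebraMap)
open Literature.NumberTheory.Automorphic Literature.NumberTheory.Automorphic.UnitaryGroup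

/-! ### §1. The scalar and the scaled blocks `t ↦ t • 1₁`, `(t, X) ↦ t • X` -/

section Scalar

variable (S : Type) [CommRing S]

/-- **`t ↦ t • 1 : Sˣ →* GL₁(S)`** — the `W₀`-block of ★ `blockGL` (`z` acts on `W₀` by the scalar `t`).
[cite: Deligne1979ShimuraVarieties, Prop. 2.3.10 (PDF p. 32)] -/
def scalarGLOne : Sˣ →* GL (Fin 1) S where
  toFun t :=
    { val := (t : S) • (1 : Matrix (Fin 1) (Fin 1) S)
      inv := ((t⁻¹ : Sˣ) : S) • (1 : Matrix (Fin 1) (Fin 1) S)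
      val_inv := by simp [smul_smul]
      inv_val := by simp [smul_smul] }
  map_one' := by
    ext1
    simp only [Units.val_one, one_smul]
  map_mul' a b := by
    ext1
    change ((a * b : Sˣ) : S) • (1 : Matrix (Fin 1) (Fin 1) S) =
      (a : S) • (1 : Matrix (Fin 1) (Fin 1) S) * ((b : S) • (1 : Matrix (Fin 1) (Fin 1) S))
    simp [smul_smul, mul_comm (b : S) (a : S)]

/-- Underlying matrix of `scalarGLOne`. [cite: Deligne1979ShimuraVarieties, Prop. 2.3.10 (PDF p. 32)] -/
@[simp] theorem coe_scalarGLOne (t : Sˣ) :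
    ((scalarGLOne S t : GL (Fin 1) S) : Matrix (Fin 1) (Fin 1) S) = (t : S) • (1 : Matrix (Fin 1) (Fin 1) S) := rfl

/-- **`(t, X) ↦ t • X : Sˣ × GL₃(S) →* GL₃(S)`** — the `V_M`-block of ★ `blockGL` (`z` acts on `V_M` by `t·X`).
[cite: Deligne1979ShimuraVarieties, Prop. 2.3.10 (PDF p. 32)] -/
def scaleGL : Sˣ × GL (Fin 3) S →* GL (Fin 3) S where
  toFun p :=
    { val := (p.1 : S) • (p.2 : Matrix (Fin 3) (Fin 3) S)
      inv := ((p.1⁻¹ : Sˣ) : S) • ((p.2⁻¹ : GL (Fin 3) S) : Matrix (Fin 3) (Fin 3) S)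
      val_inv := by simp [smul_smul]
      inv_val := by simp [smul_smul] }
  map_one' := by
    ext1
    simp only [Prod.fst_one, Prod.snd_one, Units.val_one, one_smul]
  map_mul' p q := by
    ext1
    change ((p.1 * q.1 : Sˣ) : S) • ((p.2 * q.2 : GL (Fin 3) S) : Matrix (Fin 3) (Fin 3) S) =
      (p.1 : S) • (p.2 : Matrix (Fin 3) (Fin 3) S) * ((q.1 : S) • (q.2 : Matrix (Fin 3) (Fin 3) S))
    simp [smul_smul, mul_comm (q.1 : S) (p.1 : S)]

/-- Underlying matrix of `scaleGL`. [cite: Deligne1979ShimuraVarieties, Prop. 2.3.10 (PDF p. 32)] -/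
@[simp] theorem coe_scaleGL (t : Sˣ) (X : GL (Fin 3) S) :
    ((scaleGL S (t, X) : GL (Fin 3) S) : Matrix (Fin 3) (Fin 3) S) = (t : S) • (X : Matrix (Fin 3) (Fin 3) S) := rfl

end Scalar

/-! ### §2. The two corners of `auxResFin` -/

section Corners

variable {L : Type} [Field L] [NumberField L] [IsCMField L] (M : Type) [Field M] [NumberField M] [IsCMField M]
  (j : L →+* M) (H : Matrix (Fin 3) (Fin 3) L)

/-- **The `W₀`-corner `t ↦ res(t′ • 1₁) : T₀(M)(𝔸_f) →* GL_{1×[M:ℚ]}(𝔸_{ℚ,f})`** of the frame-free carrier: the torus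
acting by scalars on `W₀ = M`, read along the basis `1 ⊗ b_k` of `𝔸_{ℚ,f} ⊗_ℚ M`.
[cite: Deligne1979ShimuraVarieties, Prop. 2.3.10 (PDF p. 32)] [cite: Deligne1971TravauxShimura, 4.9 p. 147] -/
def auxResW₀ : ↥(torusFinAdelic M) →* GL (Fin 1 × Fin (Module.finrank ℚ M)) finAdeleQ :=
  (resGL (m := Fin 1) (Algebra.TensorProduct.basis finAdeleQ (ratBasis M))).comp
    ((scalarGLOne (finAdeleQ ⊗[ℚ] M)).comp (torusToTensorFin M))

/-- **The `V`-corner `(k, t) ↦ res(t′ • X′) : U(H)(𝔸_f) × T₀(M)(𝔸_f) →* GL_{3×[M:ℚ]}(𝔸_{ℚ,f})`** of the frame-free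
carrier: the action on `V_M = V ⊗_L M`, read along the basis `eᵢ ⊗ (1 ⊗ b_k)`.
[cite: Deligne1979ShimuraVarieties, Prop. 2.3.10 (PDF p. 32)] [cite: Deligne1971TravauxShimura, 4.9 p. 147] -/
def auxResV :
    ↥(finAdelic (↥(maximalRealSubfield L)) L (IsCMField.complexConj L) 3 H) × ↥(torusFinAdelic M) →*
      GL (Fin 3 × Fin (Module.finrank ℚ M)) finAdeleQ :=
  (resGL (m := Fin 3) (Algebra.TensorProduct.basis finAdeleQ (ratBasis M))).comp
    ((scaleGL (finAdeleQ ⊗[ℚ] M)).comp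
      (MonoidHom.prod ((torusToTensorFin M).comp (MonoidHom.snd _ _))
        ((unitaryToTensorFin M j H).comp (MonoidHom.fst _ _))))

/-- Underlying matrix of the `W₀`-corner: `res(t′ • 1₁)`. [cite: Deligne1971TravauxShimura, 4.9 p. 147] -/
theorem coe_auxResW₀ (t : ↥(torusFinAdelic M)) :
    ((auxResW₀ M t : GL (Fin 1 × Fin (Module.finrank ℚ M)) finAdeleQ) :
        Matrix (Fin 1 × Fin (Module.finrank ℚ M)) (Fin 1 × Fin (Module.finrank ℚ M)) finAdeleQ) =
      resMatrix (Algebra.TensorProduct.basis finAdeleQ (ratBasis M))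
        ((torusToTensorFin M t : finAdeleQ ⊗[ℚ] M) • (1 : Matrix (Fin 1) (Fin 1) (finAdeleQ ⊗[ℚ] M))) :=
  rfl

/-- Underlying matrix of the `V`-corner: `res(t′ • X′)`. [cite: Deligne1971TravauxShimura, 4.9 p. 147] -/
theorem coe_auxResV (p : ↥(finAdelic (↥(maximalRealSubfield L)) L (IsCMField.complexConj L) 3 H) × ↥(torusFinAdelic M)) :
    ((auxResV M j H p : GL (Fin 3 × Fin (Module.finrank ℚ M)) finAdeleQ) :
        Matrix (Fin 3 × Fin (Module.finrank ℚ M)) (Fin 3 × Fin (Module.finrank ℚ M)) finAdeleQ) =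
      resMatrix (Algebra.TensorProduct.basis finAdeleQ (ratBasis M))
        ((torusToTensorFin M p.2 : finAdeleQ ⊗[ℚ] M) •
          (unitaryToTensorFin M j H p.1 : Matrix (Fin 3) (Fin 3) (finAdeleQ ⊗[ℚ] M))) :=
  rfl

/-- The `(W₀, W₀)` entries of `auxResFin p` are those of the `W₀`-corner. [cite: Deligne1971TravauxShimura, 4.9 p. 147] -/
theorem auxResFin_apply_inl_inl
    (p : ↥(finAdelic (↥(maximalRealSubfield L)) L (IsCMField.complexConj L) 3 H) × ↥(torusFinAdelic M))
    (i i' : Fin 1) (k l : Fin (Module.finrank ℚ M)) :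
    ((auxResFin M j H p : GL ((Fin 1 ⊕ Fin 3) × Fin (Module.finrank ℚ M)) finAdeleQ) :
        Matrix ((Fin 1 ⊕ Fin 3) × Fin (Module.finrank ℚ M)) ((Fin 1 ⊕ Fin 3) × Fin (Module.finrank ℚ M)) finAdeleQ)
        (Sum.inl i, k) (Sum.inl i', l) =
      ((auxResW₀ M p.2 : GL (Fin 1 × Fin (Module.finrank ℚ M)) finAdeleQ) :
        Matrix (Fin 1 × Fin (Module.finrank ℚ M)) (Fin 1 × Fin (Module.finrank ℚ M)) finAdeleQ) (i, k) (i', l) := by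
  rw [coe_auxResFin, coe_auxResW₀, resMatrix_apply, resMatrix_apply, coe_blockGL, Matrix.fromBlocks_apply₁₁]

/-- The `(V, V)` entries of `auxResFin p` are those of the `V`-corner. [cite: Deligne1971TravauxShimura, 4.9 p. 147] -/
theorem auxResFin_apply_inr_inr
    (p : ↥(finAdelic (↥(maximalRealSubfield L)) L (IsCMField.complexConj L) 3 H) × ↥(torusFinAdelic M))
    (i i' : Fin 3) (k l : Fin (Module.finrank ℚ M)) :
    ((auxResFin M j H p : GL ((Fin 1 ⊕ Fin 3) × Fin (Module.finrank ℚ M)) finAdeleQ) :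
        Matrix ((Fin 1 ⊕ Fin 3) × Fin (Module.finrank ℚ M)) ((Fin 1 ⊕ Fin 3) × Fin (Module.finrank ℚ M)) finAdeleQ)
        (Sum.inr i, k) (Sum.inr i', l) =
      ((auxResV M j H p : GL (Fin 3 × Fin (Module.finrank ℚ M)) finAdeleQ) :
        Matrix (Fin 3 × Fin (Module.finrank ℚ M)) (Fin 3 × Fin (Module.finrank ℚ M)) finAdeleQ) (i, k) (i', l) := by
  rw [coe_auxResFin, coe_auxResV, resMatrix_apply, resMatrix_apply, coe_blockGL, Matrix.fromBlocks_apply₂₂]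

/-- The `(W₀, V)` entries of `auxResFin p` vanish (the carrier is block diagonal). [cite: Deligne1979ShimuraVarieties, Prop. 2.3.10 (PDF p. 32)] -/
theorem auxResFin_apply_inl_inr
    (p : ↥(finAdelic (↥(maximalRealSubfield L)) L (IsCMField.complexConj L) 3 H) × ↥(torusFinAdelic M))
    (i : Fin 1) (i' : Fin 3) (k l : Fin (Module.finrank ℚ M)) :
    ((auxResFin M j H p : GL ((Fin 1 ⊕ Fin 3) × Fin (Module.finrank ℚ M)) finAdeleQ) :
        Matrix ((Fin 1 ⊕ Fin 3) × Fin (Module.finrank ℚ M)) ((Fin 1 ⊕ Fin 3) × Fin (Module.finrank ℚ M)) finAdeleQ)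
        (Sum.inl i, k) (Sum.inr i', l) = 0 := by
  rw [coe_auxResFin, resMatrix_apply, coe_blockGL, Matrix.fromBlocks_apply₁₂, Matrix.zero_apply, zero_mul, map_zero,
    Finsupp.zero_apply]

/-- The `(V, W₀)` entries of `auxResFin p` vanish (the carrier is block diagonal). [cite: Deligne1979ShimuraVarieties, Prop. 2.3.10 (PDF p. 32)] -/
theorem auxResFin_apply_inr_inl
    (p : ↥(finAdelic (↥(maximalRealSubfield L)) L (IsCMField.complexConj L) 3 H) × ↥(torusFinAdelic M))
    (i : Fin 3) (i' : Fin 1) (k l : Fin (Module.finrank ℚ M)) :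
    ((auxResFin M j H p : GL ((Fin 1 ⊕ Fin 3) × Fin (Module.finrank ℚ M)) finAdeleQ) :
        Matrix ((Fin 1 ⊕ Fin 3) × Fin (Module.finrank ℚ M)) ((Fin 1 ⊕ Fin 3) × Fin (Module.finrank ℚ M)) finAdeleQ)
        (Sum.inr i, k) (Sum.inl i', l) = 0 := by
  rw [coe_auxResFin, resMatrix_apply, coe_blockGL, Matrix.fromBlocks_apply₂₁, Matrix.zero_apply, zero_mul, map_zero,
    Finsupp.zero_apply]

/-- **The carrier is block diagonal with the two corners on the diagonal**: re-indexed along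
`(Fin 1 ⊕ Fin 3) × Fin d ≃ (Fin 1 × Fin d) ⊕ (Fin 3 × Fin d)` (`Equiv.sumProdDistrib`), the matrix of `auxResFin p` is
`fromBlocks (auxResW₀ p.2) 0 0 (auxResV p)`. [cite: Deligne1979ShimuraVarieties, Prop. 2.3.10 (PDF p. 32)] -/
theorem reindex_auxResFin
    (p : ↥(finAdelic (↥(maximalRealSubfield L)) L (IsCMField.complexConj L) 3 H) × ↥(torusFinAdelic M)) :
    Matrix.reindex (Equiv.sumProdDistrib (Fin 1) (Fin 3) (Fin (Module.finrank ℚ M)))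
        (Equiv.sumProdDistrib (Fin 1) (Fin 3) (Fin (Module.finrank ℚ M)))
        ((auxResFin M j H p : GL ((Fin 1 ⊕ Fin 3) × Fin (Module.finrank ℚ M)) finAdeleQ) :
          Matrix ((Fin 1 ⊕ Fin 3) × Fin (Module.finrank ℚ M)) ((Fin 1 ⊕ Fin 3) × Fin (Module.finrank ℚ M)) finAdeleQ) =
      Matrix.fromBlocks
        ((auxResW₀ M p.2 : GL (Fin 1 × Fin (Module.finrank ℚ M)) finAdeleQ) :
          Matrix (Fin 1 × Fin (Module.finrank ℚ M)) (Fin 1 × Fin (Module.finrank ℚ M)) finAdeleQ)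
        0 0
        ((auxResV M j H p : GL (Fin 3 × Fin (Module.finrank ℚ M)) finAdeleQ) :
          Matrix (Fin 3 × Fin (Module.finrank ℚ M)) (Fin 3 × Fin (Module.finrank ℚ M)) finAdeleQ) := by
  ext a c
  rcases a with ⟨i, k⟩ | ⟨i, k⟩ <;> rcases c with ⟨i', l⟩ | ⟨i', l⟩
  · rw [Matrix.reindex_apply, Matrix.submatrix_apply, Equiv.sumProdDistrib_symm_apply_left,
      Equiv.sumProdDistrib_symm_apply_left, Matrix.fromBlocks_apply₁₁, auxResFin_apply_inl_inl]
  · rw [Matrix.reindex_apply, Matrix.submatrix_apply, Equiv.sumProdDistrib_symm_apply_left,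
      Equiv.sumProdDistrib_symm_apply_right, Matrix.fromBlocks_apply₁₂, auxResFin_apply_inl_inr, Matrix.zero_apply]
  · rw [Matrix.reindex_apply, Matrix.submatrix_apply, Equiv.sumProdDistrib_symm_apply_right,
      Equiv.sumProdDistrib_symm_apply_left, Matrix.fromBlocks_apply₂₁, auxResFin_apply_inr_inl, Matrix.zero_apply]
  · rw [Matrix.reindex_apply, Matrix.submatrix_apply, Equiv.sumProdDistrib_symm_apply_right,
      Equiv.sumProdDistrib_symm_apply_right, Matrix.fromBlocks_apply₂₂, auxResFin_apply_inr_inr]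

/-- `auxResV (1, t) = res(t′ • 1₃)`: on `V` the torus alone acts by scalars. [cite: Deligne1979ShimuraVarieties, Prop. 2.3.10 (PDF p. 32)] -/
theorem coe_auxResV_one_mk (t : ↥(torusFinAdelic M)) :
    ((auxResV M j H (1, t) : GL (Fin 3 × Fin (Module.finrank ℚ M)) finAdeleQ) :
        Matrix (Fin 3 × Fin (Module.finrank ℚ M)) (Fin 3 × Fin (Module.finrank ℚ M)) finAdeleQ) =
      resMatrix (Algebra.TensorProduct.basis finAdeleQ (ratBasis M))
        ((torusToTensorFin M t : finAdeleQ ⊗[ℚ] M) • (1 : Matrix (Fin 3) (Fin 3) (finAdeleQ ⊗[ℚ] M))) := by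
  rw [coe_auxResV, map_one, Units.val_one]

/-! ### §3. Continuity of the corners -/

/-- **The `V`-corner is continuous** (its entries are entries of the continuous ★ `auxResFin`; inverses through the
group law). [cite: Deligne1979ShimuraVarieties, Prop. 2.3.10 (PDF p. 32)] [cite: CasselsFrohlichANT1967, Ch. II §14 Lemma (14.2)] -/
theorem continuous_auxResV : Continuous (auxResV M j H) := by
  have hval : Continuous fun p : ↥(finAdelic (↥(maximalRealSubfield L)) L (IsCMField.complexConj L) 3 H) ×
      ↥(torusFinAdelic M) =>
      ((auxResV M j H p : GL (Fin 3 × Fin (Module.finrank ℚ M)) finAdeleQ) :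
        Matrix (Fin 3 × Fin (Module.finrank ℚ M)) (Fin 3 × Fin (Module.finrank ℚ M)) finAdeleQ) := by
    refine continuous_matrix fun ik il => ?_
    obtain ⟨i, k⟩ := ik
    obtain ⟨i', l⟩ := il
    have h : (fun p : ↥(finAdelic (↥(maximalRealSubfield L)) L (IsCMField.complexConj L) 3 H) × ↥(torusFinAdelic M) =>
        ((auxResV M j H p : GL (Fin 3 × Fin (Module.finrank ℚ M)) finAdeleQ) :
          Matrix (Fin 3 × Fin (Module.finrank ℚ M)) (Fin 3 × Fin (Module.finrank ℚ M)) finAdeleQ) (i, k) (i', l)) =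
        fun p => ((auxResFin M j H p : GL ((Fin 1 ⊕ Fin 3) × Fin (Module.finrank ℚ M)) finAdeleQ) :
          Matrix ((Fin 1 ⊕ Fin 3) × Fin (Module.finrank ℚ M)) ((Fin 1 ⊕ Fin 3) × Fin (Module.finrank ℚ M)) finAdeleQ)
          (Sum.inr i, k) (Sum.inr i', l) := by
      funext p
      rw [auxResFin_apply_inr_inr]
    rw [h]
    exact (continuous_coe_auxResFin M j H).matrix_elem _ _
  rw [Units.continuous_iff]
  refine ⟨hval, ?_⟩
  exact (hval.comp continuous_inv).congr fun p => by simp only [Function.comp_apply, map_inv]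

/-- Entries of the `W₀`-corner: the `k`-th coordinate of `t · b_l` (`Fin 1` carries no information).
[cite: Deligne1971TravauxShimura, 4.9 p. 147] -/
theorem auxResW₀_apply (t : ↥(torusFinAdelic M)) (i i' : Fin 1) (k l : Fin (Module.finrank ℚ M)) :
    ((auxResW₀ M t : GL (Fin 1 × Fin (Module.finrank ℚ M)) finAdeleQ) :
        Matrix (Fin 1 × Fin (Module.finrank ℚ M)) (Fin 1 × Fin (Module.finrank ℚ M)) finAdeleQ) (i, k) (i', l) =
      (Algebra.TensorProduct.basis finAdeleQ (ratBasis M)).repr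
        ((ratFiniteAdeleTensorEquiv M).symm
          ((((t : ↥(torusFinAdelic M)) : (FiniteAdeleRing (𝓞 M) M)ˣ) : FiniteAdeleRing (𝓞 M) M) *
            algebraMap M (FiniteAdeleRing (𝓞 M) M) (ratBasis M l))) k := by
  obtain rfl : i = i' := Subsingleton.elim _ _
  have hcoe : ((torusToTensorFin M t : (finAdeleQ ⊗[ℚ] M)ˣ) : finAdeleQ ⊗[ℚ] M) =
      (ratFiniteAdeleTensorEquiv M).symm (((t : ↥(torusFinAdelic M)) : (FiniteAdeleRing (𝓞 M) M)ˣ) :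
        FiniteAdeleRing (𝓞 M) M) := rfl
  rw [coe_auxResW₀, resMatrix_apply, Matrix.smul_apply, Matrix.one_apply_eq, smul_eq_mul, mul_one, hcoe,
    Algebra.TensorProduct.basis_apply, ← ratFiniteAdeleTensorEquiv_symm_algebraMap, ← map_mul]

/-- **The `W₀`-corner is continuous** (coordinate functionals of `𝔸_{M,f}` are continuous, ★
`continuous_basis_repr_ratFiniteAdeleTensorEquiv_symm`). [cite: CasselsFrohlichANT1967, Ch. II §14 Lemma (14.2)] -/
theorem continuous_auxResW₀ : Continuous (auxResW₀ M) := by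
  have hval : Continuous fun t : ↥(torusFinAdelic M) =>
      ((auxResW₀ M t : GL (Fin 1 × Fin (Module.finrank ℚ M)) finAdeleQ) :
        Matrix (Fin 1 × Fin (Module.finrank ℚ M)) (Fin 1 × Fin (Module.finrank ℚ M)) finAdeleQ) := by
    refine continuous_matrix fun ik il => ?_
    obtain ⟨i, k⟩ := ik
    obtain ⟨i', l⟩ := il
    have h : (fun t : ↥(torusFinAdelic M) =>
        ((auxResW₀ M t : GL (Fin 1 × Fin (Module.finrank ℚ M)) finAdeleQ) :
          Matrix (Fin 1 × Fin (Module.finrank ℚ M)) (Fin 1 × Fin (Module.finrank ℚ M)) finAdeleQ) (i, k) (i', l)) =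
        fun t => (Algebra.TensorProduct.basis finAdeleQ (ratBasis M)).repr
          ((ratFiniteAdeleTensorEquiv M).symm
            ((((t : ↥(torusFinAdelic M)) : (FiniteAdeleRing (𝓞 M) M)ˣ) : FiniteAdeleRing (𝓞 M) M) *
              algebraMap M (FiniteAdeleRing (𝓞 M) M) (ratBasis M l))) k := by
      funext t
      rw [auxResW₀_apply]
    rw [h]
    exact (continuous_basis_repr_ratFiniteAdeleTensorEquiv_symm M k).comp
      ((Units.continuous_val.comp continuous_subtype_val).mul continuous_const)
  rw [Units.continuous_iff]
  refine ⟨hval, ?_⟩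
  exact (hval.comp continuous_inv).congr fun t => by simp only [Function.comp_apply, map_inv]

end Corners

end Literature.AlgebraicGeometry.ShimuraVarieties.UnitaryCanonicalModel.Aux

end
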